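import Summits.Ventures.LatticeQCDFlow.Scaling.SimulatedTemperingAlgorithm
import Summits.Ventures.LatticeQCDFlow.Scaling.SimulatedTemperingDiffusiveInstances

/-!
HONEST FRAMING: exact (Metropolis-corrected) sampling algorithms for lattice gauge theory; figures
of merit are autocorrelation/cost numbers at stated couplings and volumes; no continuum-physics
claim.

# SimulatedTemperingAlgorithmWilson — THE SIMULATED-TEMPERING SAMPLER OF THE WILSON MEASURE (EXACT-WEIGHT
# METROPOLIS COUPLING MOVE + ANY EXACT GAUGE-FIELD UPDATES AT THE CURRENT COUPLING) IS DIFFUSIVE IN THE COUPLING,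
# FOR EVERY COMPACT GAUGE GROUP AT EVERY COUPLING; ORDER-ONE CONSTANTS IN TWO DIMENSIONS AND AT STRONG COUPLING;
# `τ_int` OF THE COUPLING INDEX FOR REVERSIBLE UPDATES (lean-2 GEN-14, ours)

Venture-side (OURS).  Cell `lqcd-flow` (pub-lqcd), unit `pub-lqcd-lean-2-g14`, 2026-08-24.  The gauge-theory
docking of `Scaling/SimulatedTemperingAlgorithm`: there the deterministic-scan sampler
`stWithinLevel M ∘ₖ stLevelKernel` and the random-scan sampler `mixtureKernel t (stLevelKernel …) (stWithinLevel M)`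
were shown to satisfy hypotheses (i)–(iii) of GEN-13's laws for ANY family `M k` of exact within-level Markov
kernels.  Here `Ω = G^E` (gauge fields on the periodic lattice), `μ = D[U]` (product Haar), `X = −S_W`, so that
`μ_u = D[U].tilted(u·(−S_W))` IS the Wilson measure at coupling `u` (`tilted_neg_wilsonAction_eq`), and `M k` is
ANY Markov kernel on gauge fields leaving the Wilson measure at the ladder coupling `β_k = a + k(b−a)/K`
invariant — heat bath, over-relaxation, HMC, a Metropolis-corrected trivializing flow at coupling `β_k`.

## What is proved (uniform ladder from `a` to `b`, `−B ≤ a < b ≤ B`, `K ≥ 1`;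
## `M k` Markov with `wilsonMeasure ρ β_k` invariant)

* **`wilson_stScan_level_lagOneAutocorr_ge_allCouplings`** (every compact second-countable `G`, unitary
  continuous `ρ : G →* M_N(ℂ)`, `d ≥ 2`, `L ≥ 2`, `Var_Haar(Re tr ρ) > 0`): for the sampler
  `stWithinLevel M ∘ₖ stLevelKernel`, `1 − 96·e^{B·2NK'(1+4K')}/(e·⌊L/2⌋^d·Var_Haar(Re tr ρ)·(b−a)²) ≤ ρ_lev(1)`,
  `K' = (d+1)d²` (GEN-9's all-coupling specific-heat floor); **`wilson_stMix_level_lagOneAutocorr_ge_allCouplings`**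
  — the same for the random-scan sampler, every `t ∈ [0,1]`.
* **`wilson_stMix_level_tauInt_ge_allCouplings`** — random scan, every `M k` REVERSIBLE for `wilsonMeasure ρ β_k`
  (heat bath, Metropolis, exact flow proposals), summable level autocorrelations with `ρ(1) < 1`:
  `e·m·(b−a)²/96 − ½ ≤ τ_int(level)`, `m = e^{−B·2NK'(1+4K')}·⌊L/2⌋^d·Var_Haar(Re tr ρ)`.
* **`wilson_stScan_level_lagOneAutocorr_ge_twoDim`** (`d = 2`, any compact `G`, continuous `ρ`,
  `m₂ = e^{−4NB}(L²−1)Var_Haar(Re tr ρ)/2 − N² > 0`): `1 − 96/(e·m₂·(b−a)²) ≤ ρ_lev(1)` (GEN-12's pinched floor).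
* **`wilson_stScan_level_lagOneAutocorr_ge_sun_strongCoupling`** (`SU(n)`, `n ≥ 3`, every `d ≥ 2`, `L ≥ 2`,
  window inside the Kotecký–Preiss radius): `1 − 384/(e·#plaq·(b−a)²) ≤ ρ_lev(1)`.

Reading (no numerics implied): simulated tempering of the Wilson measure across a coupling window, run with ANY
exact gauge-field update between coupling moves and ANY number of levels, needs `Ω(heat capacity × (b−a)²)`
steps per decorrelation of its coupling — `Ω(volume·(b−a)²)` at every coupling, with order-one constants in two
dimensions and at strong coupling.  NOT CLAIMED: ergodicity of the samplers (depends on `M`); the summability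
provisos; the size of the all-coupling constant (GEN-9's, structural); `SU(2)` and boundary-condition tempering
versions (the GEN-13 kernel-level laws `…_su2_strongCoupling`, `defect_st_level_lagOneAutocorr_ge` apply verbatim
to these samplers; not restated); any measured number.  Literature grade (cell rule): TEXTBOOK ALGORITHM + KNOWN
MECHANISM (Marinari–Parisi 1992; Katzgraber–Trebst–Huse–Troyer 2006), NEW TYPING; nothing cited as a fact.
-/

noncomputable section

open MeasureTheory ProbabilityTheory Set Filter Finset
open Literature.MathematicalPhysics.QuantumFieldTheory
open Literature.MathematicalPhysics.QuantumFieldTheory.Luscher2010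
open Summit.Ventures.LatticeQCDFlow.Scoring
open Summit.Ventures.LatticeQCDFlow.TrivializingMaps
open scoped ENNReal

namespace Summit.Ventures.LatticeQCDFlow.Scaling

/-! ## §1 Every compact gauge group, every coupling -/

section Wilson

variable {d L N : ℕ} [NeZero L] {G : Type*} [Group G] [TopologicalSpace G] [IsTopologicalGroup G]
  [CompactSpace G] [MeasurableSpace G] [BorelSpace G] [SecondCountableTopology G]
  (ρ : G →* Matrix (Fin N) (Fin N) ℂ)

/-- Exact within-level updates for the Wilson measures at the ladder couplings are exact for the tilts
`D[U].tilted(β_k·(−S_W))` (the same measures). [ours] -/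
theorem wilson_withinLevel_invariant_tilted (hρ : Continuous ρ) {K : ℕ} (β : ℕ → ℝ)
    (M : Fin (K + 1) → Kernel (GaugeConfig d L G) (GaugeConfig d L G))
    (hM : ∀ k : Fin (K + 1), Kernel.Invariant (M k) (wilsonMeasure (d := d) (L := L) ρ (β k))) (k : Fin (K + 1)) :
    Kernel.Invariant (M k) ((trivialMeasure G d L).tilted fun U => β k * (-wilsonAction ρ U)) := by
  rw [tilted_neg_wilsonAction_eq ρ hρ]; exact hM k

/-- **SIMULATED TEMPERING OF THE WILSON MEASURE IS DIFFUSIVE IN THE COUPLING — FOR THE SAMPLER ITSELF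
(deterministic scan).**  Unitary continuous `ρ`, `d ≥ 2`, `L ≥ 2`, `Var_Haar(Re tr ρ) > 0`, `−B ≤ a < b ≤ B`,
`K ≥ 1`; `M k` ANY Markov kernels on gauge fields leaving the Wilson measures at the ladder couplings
`β_k = a + k(b−a)/K` invariant.  Then the sampler "exact-weight Metropolis coupling move, then `M` at the current
coupling" (`stWithinLevel M ∘ₖ stLevelKernel`) satisfies
`1 − 96·e^{B·2NK'(1+4K')}/(e·⌊L/2⌋^d·Var_Haar(Re tr ρ)·(b−a)²) ≤ ρ_lev(1)`, `K' = (d+1)d²`. [ours] -/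
theorem wilson_stScan_level_lagOneAutocorr_ge_allCouplings (hd : 2 ≤ d) (hL : 2 ≤ L) (hρ : Continuous ρ)
    (hρu : ∀ g, ρ g ∈ Matrix.unitaryGroup (Fin N) ℂ)
    (hv : 0 < variance (fun g => (ρ g).trace.re) (haarProbability G)) {a b B : ℝ} (ha : -B ≤ a)
    (hab : a < b) (hb : b ≤ B) {K : ℕ} (hK : 1 ≤ K)
    (M : Fin (K + 1) → Kernel (GaugeConfig d L G) (GaugeConfig d L G)) [∀ k, IsMarkovKernel (M k)]
    (hM : ∀ k : Fin (K + 1), Kernel.Invariant (M k) (wilsonMeasure (d := d) (L := L) ρ (a + k * ((b - a) / K)))) :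
    1 - 96 * Real.exp (B * (2 * N * ((d + 1) * d ^ 2 : ℕ) * (1 + 4 * ((d + 1) * d ^ 2 : ℕ)))) /
        (Real.exp 1 * (((L / 2) ^ d : ℕ) * variance (fun g => (ρ g).trace.re) (haarProbability G)) *
          (b - a) ^ 2) ≤
      (autocov (stWithinLevel M ∘ₖ stLevelKernel (measurable_neg_wilsonAction ρ hρ) (trivialMeasure G d L)
            (fun k => a + k * ((b - a) / K)) K)
          (stTarget (fun U => -wilsonAction ρ U) (trivialMeasure G d L) (fun k => a + k * ((b - a) / K)) K)
          (fun z => (((z.1 : Fin (K + 1)) : ℕ) : ℝ)) 1 - ((K : ℝ) / 2) ^ 2) / (K * (K + 2) / 12) := by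
  haveI : IsProbabilityMeasure (trivialMeasure G d L) := trivialMeasure_isProbabilityMeasure
  have hM' := wilson_withinLevel_invariant_tilted ρ hρ (fun k => a + k * ((b - a) / K)) M hM
  exact wilson_st_level_lagOneAutocorr_ge_allCouplings ρ hd hL hρ hρu hv ha hab hb hK _
    (stScan_invariant (β := fun k => a + k * ((b - a) / K)) (measurable_neg_wilsonAction ρ hρ)
      (neg_wilsonAction_bounded ρ hρ) M hM')
    (stScan_nearestNeighbour (measurable_neg_wilsonAction ρ hρ) M)
    (fun k U hk => stScan_real_up_le (β := fun k => a + k * ((b - a) / K)) (measurable_neg_wilsonAction ρ hρ) M k U hk)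
    (fun k U hk => stScan_real_down_le (β := fun k => a + k * ((b - a) / K)) (measurable_neg_wilsonAction ρ hρ) M k U hk)

/-- **The random-scan Wilson sampler** (`t·stLevelKernel + (1−t)·stWithinLevel M`, every `t ∈ [0,1]`) obeys the
same all-coupling law. [ours] -/
theorem wilson_stMix_level_lagOneAutocorr_ge_allCouplings (hd : 2 ≤ d) (hL : 2 ≤ L) (hρ : Continuous ρ)
    (hρu : ∀ g, ρ g ∈ Matrix.unitaryGroup (Fin N) ℂ)
    (hv : 0 < variance (fun g => (ρ g).trace.re) (haarProbability G)) {a b B : ℝ} (ha : -B ≤ a)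
    (hab : a < b) (hb : b ≤ B) {K : ℕ} (hK : 1 ≤ K) (t : unitInterval)
    (M : Fin (K + 1) → Kernel (GaugeConfig d L G) (GaugeConfig d L G)) [∀ k, IsMarkovKernel (M k)]
    (hM : ∀ k : Fin (K + 1), Kernel.Invariant (M k) (wilsonMeasure (d := d) (L := L) ρ (a + k * ((b - a) / K)))) :
    1 - 96 * Real.exp (B * (2 * N * ((d + 1) * d ^ 2 : ℕ) * (1 + 4 * ((d + 1) * d ^ 2 : ℕ)))) /
        (Real.exp 1 * (((L / 2) ^ d : ℕ) * variance (fun g => (ρ g).trace.re) (haarProbability G)) *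
          (b - a) ^ 2) ≤
      (autocov (mixtureKernel t (stLevelKernel (measurable_neg_wilsonAction ρ hρ) (trivialMeasure G d L)
              (fun k => a + k * ((b - a) / K)) K) (stWithinLevel M))
          (stTarget (fun U => -wilsonAction ρ U) (trivialMeasure G d L) (fun k => a + k * ((b - a) / K)) K)
          (fun z => (((z.1 : Fin (K + 1)) : ℕ) : ℝ)) 1 - ((K : ℝ) / 2) ^ 2) / (K * (K + 2) / 12) := by
  haveI : IsProbabilityMeasure (trivialMeasure G d L) := trivialMeasure_isProbabilityMeasure
  have hM' := wilson_withinLevel_invariant_tilted ρ hρ (fun k => a + k * ((b - a) / K)) M hM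
  exact wilson_st_level_lagOneAutocorr_ge_allCouplings ρ hd hL hρ hρu hv ha hab hb hK _
    (stMix_invariant (β := fun k => a + k * ((b - a) / K)) (measurable_neg_wilsonAction ρ hρ)
      (neg_wilsonAction_bounded ρ hρ) t M hM')
    (stMix_nearestNeighbour (measurable_neg_wilsonAction ρ hρ) t M)
    (fun k U hk => stMix_real_up_le (β := fun k => a + k * ((b - a) / K)) (measurable_neg_wilsonAction ρ hρ) t M k U hk)
    (fun k U hk => stMix_real_down_le (β := fun k => a + k * ((b - a) / K)) (measurable_neg_wilsonAction ρ hρ) t M k U hk)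

/-- **`τ_int` OF THE COUPLING INDEX OF THE RANDOM-SCAN WILSON SAMPLER WITH REVERSIBLE GAUGE-FIELD UPDATES**
(unitary continuous `ρ`, `d ≥ 2`, `L ≥ 2`, `Var_Haar(Re tr ρ) > 0`, `−B ≤ a < b ≤ B`, `K ≥ 1`, every `t`; every
`M k` reversible for the Wilson measure at `β_k`; summable level autocorrelations with `ρ(1) < 1`):
`e·m·(b−a)²/96 − ½ ≤ τ_int(level)`, `m = e^{−B·2NK'(1+4K')}·⌊L/2⌋^d·Var_Haar(Re tr ρ)`, `K' = (d+1)d²`. [ours] -/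
theorem wilson_stMix_level_tauInt_ge_allCouplings (hd : 2 ≤ d) (hL : 2 ≤ L) (hρ : Continuous ρ)
    (hρu : ∀ g, ρ g ∈ Matrix.unitaryGroup (Fin N) ℂ)
    (hv : 0 < variance (fun g => (ρ g).trace.re) (haarProbability G)) {a b B : ℝ} (ha : -B ≤ a)
    (hab : a < b) (hb : b ≤ B) {K : ℕ} (hK : 1 ≤ K) (t : unitInterval)
    (M : Fin (K + 1) → Kernel (GaugeConfig d L G) (GaugeConfig d L G)) [∀ k, IsMarkovKernel (M k)]
    (hM : ∀ k : Fin (K + 1), Kernel.IsReversible (M k) (wilsonMeasure (d := d) (L := L) ρ (a + k * ((b - a) / K))))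
    (hs : Summable fun n =>
      autocov (mixtureKernel t (stLevelKernel (measurable_neg_wilsonAction ρ hρ) (trivialMeasure G d L)
          (fun k => a + k * ((b - a) / K)) K) (stWithinLevel M))
        (stTarget (fun U => -wilsonAction ρ U) (trivialMeasure G d L) (fun k => a + k * ((b - a) / K)) K)
        (fun z => (((z.1 : Fin (K + 1)) : ℕ) : ℝ) - K / 2) (n + 1) /
      autocov (mixtureKernel t (stLevelKernel (measurable_neg_wilsonAction ρ hρ) (trivialMeasure G d L)
          (fun k => a + k * ((b - a) / K)) K) (stWithinLevel M))
        (stTarget (fun U => -wilsonAction ρ U) (trivialMeasure G d L) (fun k => a + k * ((b - a) / K)) K)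
        (fun z => (((z.1 : Fin (K + 1)) : ℕ) : ℝ) - K / 2) 0)
    (hρ1 : autocov (mixtureKernel t (stLevelKernel (measurable_neg_wilsonAction ρ hρ) (trivialMeasure G d L)
          (fun k => a + k * ((b - a) / K)) K) (stWithinLevel M))
        (stTarget (fun U => -wilsonAction ρ U) (trivialMeasure G d L) (fun k => a + k * ((b - a) / K)) K)
        (fun z => (((z.1 : Fin (K + 1)) : ℕ) : ℝ) - K / 2) 1 /
      autocov (mixtureKernel t (stLevelKernel (measurable_neg_wilsonAction ρ hρ) (trivialMeasure G d L)
          (fun k => a + k * ((b - a) / K)) K) (stWithinLevel M))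
        (stTarget (fun U => -wilsonAction ρ U) (trivialMeasure G d L) (fun k => a + k * ((b - a) / K)) K)
        (fun z => (((z.1 : Fin (K + 1)) : ℕ) : ℝ) - K / 2) 0 < 1) :
    Real.exp 1 * (Real.exp (-(B * (2 * N * ((d + 1) * d ^ 2 : ℕ) * (1 + 4 * ((d + 1) * d ^ 2 : ℕ))))) *
        ((L / 2) ^ d : ℕ) * variance (fun g => (ρ g).trace.re) (haarProbability G)) * (b - a) ^ 2 / 96 - 1 / 2 ≤
      tauInt (fun n =>
        autocov (mixtureKernel t (stLevelKernel (measurable_neg_wilsonAction ρ hρ) (trivialMeasure G d L)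
            (fun k => a + k * ((b - a) / K)) K) (stWithinLevel M))
          (stTarget (fun U => -wilsonAction ρ U) (trivialMeasure G d L) (fun k => a + k * ((b - a) / K)) K)
          (fun z => (((z.1 : Fin (K + 1)) : ℕ) : ℝ) - K / 2) n /
        autocov (mixtureKernel t (stLevelKernel (measurable_neg_wilsonAction ρ hρ) (trivialMeasure G d L)
            (fun k => a + k * ((b - a) / K)) K) (stWithinLevel M))
          (stTarget (fun U => -wilsonAction ρ U) (trivialMeasure G d L) (fun k => a + k * ((b - a) / K)) K)
          (fun z => (((z.1 : Fin (K + 1)) : ℕ) : ℝ) - K / 2) 0) := by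
  haveI : IsProbabilityMeasure (trivialMeasure G d L) := trivialMeasure_isProbabilityMeasure
  set m : ℝ := Real.exp (-(B * (2 * N * ((d + 1) * d ^ 2 : ℕ) * (1 + 4 * ((d + 1) * d ^ 2 : ℕ))))) *
    ((L / 2) ^ d : ℕ) * variance (fun g => (ρ g).trace.re) (haarProbability G) with hm_def
  have hLd : 0 < ((L / 2) ^ d : ℕ) := by
    have : 1 ≤ L / 2 := Nat.le_div_iff_mul_le (by norm_num) |>.2 (by omega)
    exact pow_pos (by omega) d
  have hm0 : 0 < m := by
    rw [hm_def]
    refine mul_pos (mul_pos (Real.exp_pos _) ?_) hv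
    exact_mod_cast hLd
  -- the all-coupling floor on the window `[a,b] ⊆ [−B,B]`
  have hfloor : ∀ u ∈ Icc a b, m ≤ variance (fun U => -wilsonAction ρ U)
      ((trivialMeasure G d L).tilted fun U => u * (-wilsonAction ρ U)) := by
    intro u hu
    rw [tilted_neg_wilsonAction_eq ρ hρ u, variance_fun_neg]
    refine le_trans ?_ (wilson_variance_ge_allCouplings (d := d) (L := L) ρ hd hL hρ hρu u)
    have hvn : 0 ≤ variance (fun g => (ρ g).trace.re) (haarProbability G) := variance_nonneg _ _
    have hu' : |u| ≤ B := abs_le.2 ⟨by linarith [hu.1], by linarith [hu.2]⟩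
    have hc : 0 ≤ (2 * N * ((d + 1) * d ^ 2 : ℕ) * (1 + 4 * ((d + 1) * d ^ 2 : ℕ)) : ℝ) := by positivity
    rw [hm_def]
    gcongr
  have hMt : ∀ k : Fin (K + 1), Kernel.IsReversible (M k)
      ((trivialMeasure G d L).tilted fun U => (a + k * ((b - a) / K)) * (-wilsonAction ρ U)) := fun k => by
    rw [tilted_neg_wilsonAction_eq ρ hρ]; exact hM k
  exact stMix_level_tauInt_ge_kfree (measurable_neg_wilsonAction ρ hρ) (neg_wilsonAction_bounded ρ hρ) hab hm0
    hfloor hK t M hMt hs hρ1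

end Wilson

/-! ## §2 Two dimensions: the pinched specific heat gives an order-one constant -/

section TwoDim

variable {L N : ℕ} [NeZero L] {G : Type*} [Group G] [TopologicalSpace G] [IsTopologicalGroup G]
  [CompactSpace G] [MeasurableSpace G] [BorelSpace G] [SecondCountableTopology G]
  (ρ : G →* Matrix (Fin N) (Fin N) ℂ)

/-- **TWO DIMENSIONS, EVERY COMPACT GAUGE GROUP, EVERY COUPLING WINDOW** (`L ≥ 2`, continuous `ρ`,
`−B ≤ a < b ≤ B`, `m₂ = e^{−4NB}(L²−1)Var_Haar(Re tr ρ)/2 − N² > 0`, `K ≥ 1`; `M k` ANY Markov kernels leaving the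
two-dimensional Wilson measures at the ladder couplings invariant): the sampler `stWithinLevel M ∘ₖ stLevelKernel`
has `1 − 96/(e·m₂·(b−a)²) ≤ ρ_lev(1)`. [ours] -/
theorem wilson_stScan_level_lagOneAutocorr_ge_twoDim (hL : 2 ≤ L) (hρ : Continuous ρ) {a b B : ℝ} (ha : -B ≤ a)
    (hab : a < b) (hb : b ≤ B)
    (hm : 0 < Real.exp (-(4 * N * B)) * ((L : ℝ) ^ 2 - 1) *
      variance (fun g : G => (ρ g).trace.re) (haarProbability G) / 2 - (N : ℝ) ^ 2)
    {K : ℕ} (hK : 1 ≤ K)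
    (M : Fin (K + 1) → Kernel (GaugeConfig 2 L G) (GaugeConfig 2 L G)) [∀ k, IsMarkovKernel (M k)]
    (hM : ∀ k : Fin (K + 1), Kernel.Invariant (M k) (wilsonMeasure (d := 2) (L := L) ρ (a + k * ((b - a) / K)))) :
    1 - 96 / (Real.exp 1 * (Real.exp (-(4 * N * B)) * ((L : ℝ) ^ 2 - 1) *
        variance (fun g : G => (ρ g).trace.re) (haarProbability G) / 2 - (N : ℝ) ^ 2) * (b - a) ^ 2) ≤
      (autocov (stWithinLevel M ∘ₖ stLevelKernel (measurable_neg_wilsonAction ρ hρ) (trivialMeasure G 2 L)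
            (fun k => a + k * ((b - a) / K)) K)
          (stTarget (fun U => -wilsonAction ρ U) (trivialMeasure G 2 L) (fun k => a + k * ((b - a) / K)) K)
          (fun z => (((z.1 : Fin (K + 1)) : ℕ) : ℝ)) 1 - ((K : ℝ) / 2) ^ 2) / (K * (K + 2) / 12) := by
  haveI : IsProbabilityMeasure (trivialMeasure G 2 L) := trivialMeasure_isProbabilityMeasure
  have hM' := wilson_withinLevel_invariant_tilted ρ hρ (fun k => a + k * ((b - a) / K)) M hM
  exact wilson_st_level_lagOneAutocorr_ge_twoDim ρ hL hρ ha hab hb hm hK _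
    (stScan_invariant (β := fun k => a + k * ((b - a) / K)) (measurable_neg_wilsonAction ρ hρ)
      (neg_wilsonAction_bounded ρ hρ) M hM')
    (stScan_nearestNeighbour (measurable_neg_wilsonAction ρ hρ) M)
    (fun k U hk => stScan_real_up_le (β := fun k => a + k * ((b - a) / K)) (measurable_neg_wilsonAction ρ hρ) M k U hk)
    (fun k U hk => stScan_real_down_le (β := fun k => a + k * ((b - a) / K)) (measurable_neg_wilsonAction ρ hρ) M k U hk)

end TwoDim

/-! ## §3 `SU(n)` at strong coupling: an order-one constant per plaquette -/

section StrongCoupling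

variable {d L n : ℕ} [NeZero L]

/-- **`SU(n)`, `n ≥ 3`, AT STRONG COUPLING** (every `d ≥ 2`, `L ≥ 2`; window `a < b` inside the Kotecký–Preiss
radius as in `wilson_st_level_lagOneAutocorr_ge_sun_strongCoupling`; `K ≥ 1`; `M k` ANY Markov kernels leaving the
`SU(n)` Wilson measures at the ladder couplings invariant): the sampler `stWithinLevel M ∘ₖ stLevelKernel` has
`1 − 384/(e·#plaq·(b−a)²) ≤ ρ_lev(1)`. [ours] -/
theorem wilson_stScan_level_lagOneAutocorr_ge_sun_strongCoupling (hd : 2 ≤ d) (hn : 3 ≤ n) (hL : 2 ≤ L)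
    {a b : ℝ} (hab : a < b)
    (ha : |a| ≤ min (1 / (8 * Real.exp 1 * (n : ℝ) * ((3 : ℝ) ^ d * (d : ℝ) ^ 2 + 1) ^ 2) / 8)
      ((1 / 2 : ℝ) * (1 / (8 * Real.exp 1 * (n : ℝ) * ((3 : ℝ) ^ d * (d : ℝ) ^ 2 + 1) ^ 2)) ^ 3 / 512))
    (hb : |b| ≤ min (1 / (8 * Real.exp 1 * (n : ℝ) * ((3 : ℝ) ^ d * (d : ℝ) ^ 2 + 1) ^ 2) / 8)
      ((1 / 2 : ℝ) * (1 / (8 * Real.exp 1 * (n : ℝ) * ((3 : ℝ) ^ d * (d : ℝ) ^ 2 + 1) ^ 2)) ^ 3 / 512))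
    {K : ℕ} (hK : 1 ≤ K)
    (M : Fin (K + 1) → Kernel (GaugeConfig d L (Matrix.specialUnitaryGroup (Fin n) ℂ))
      (GaugeConfig d L (Matrix.specialUnitaryGroup (Fin n) ℂ))) [∀ k, IsMarkovKernel (M k)]
    (hM : ∀ k : Fin (K + 1), Kernel.Invariant (M k)
      (wilsonMeasure (d := d) (L := L) (StrongCoupling.defRep n) (a + k * ((b - a) / K)))) :
    1 - 384 / (Real.exp 1 * Fintype.card (Plaquette d L) * (b - a) ^ 2) ≤
      (autocov (stWithinLevel M ∘ₖ stLevelKernel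
              (measurable_neg_wilsonAction (StrongCoupling.defRep n) continuous_subtype_val)
              (trivialMeasure (Matrix.specialUnitaryGroup (Fin n) ℂ) d L) (fun k => a + k * ((b - a) / K)) K)
          (stTarget (fun U => -wilsonAction (StrongCoupling.defRep n) U)
            (trivialMeasure (Matrix.specialUnitaryGroup (Fin n) ℂ) d L) (fun k => a + k * ((b - a) / K)) K)
          (fun z => (((z.1 : Fin (K + 1)) : ℕ) : ℝ)) 1 - ((K : ℝ) / 2) ^ 2) / (K * (K + 2) / 12) := by
  haveI : IsProbabilityMeasure (trivialMeasure (Matrix.specialUnitaryGroup (Fin n) ℂ) d L) :=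
    trivialMeasure_isProbabilityMeasure
  have hρ : Continuous (StrongCoupling.defRep n) := continuous_subtype_val
  have hM' := wilson_withinLevel_invariant_tilted (StrongCoupling.defRep n) hρ (fun k => a + k * ((b - a) / K)) M hM
  exact wilson_st_level_lagOneAutocorr_ge_sun_strongCoupling hd hn hL hab ha hb hK _
    (stScan_invariant (β := fun k => a + k * ((b - a) / K)) (measurable_neg_wilsonAction _ hρ)
      (neg_wilsonAction_bounded _ hρ) M hM')
    (stScan_nearestNeighbour (measurable_neg_wilsonAction _ hρ) M)
    (fun k U hk => stScan_real_up_le (β := fun k => a + k * ((b - a) / K)) (measurable_neg_wilsonAction _ hρ) M k U hk)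
    (fun k U hk => stScan_real_down_le (β := fun k => a + k * ((b - a) / K)) (measurable_neg_wilsonAction _ hρ) M k U hk)

end StrongCoupling

end Summit.Ventures.LatticeQCDFlow.Scaling

end
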